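import Summits.QuantumFields.BalabanUV.Beta.KernelWardMColumn
import Summits.QuantumFields.BalabanUV.Beta.NVertexLamK1Prime
import Literature.MathematicalPhysics.QuantumFieldTheory.Balaban1983to89.Beta.ResolventReflection

/-!
# `BalabanUV.Beta.FP.TowerK2bDoorReadoutColumn` — binder row D1, the row's ONE file (J-NOTE-19 §3–§4), **LEMMA C AND LEMMA R AT THE RECORD's LETTER**:
# the door tadpole's read-out column is the straight system's multiplier response `wΦ` (`NVertexLamK1Prime.AN_inr_inr_smul`: the composite one-shot chart's
# multiplier–multiplier block at coarse points IS `wΦ (N := Lc^(j+1)) κ ν (y − z)` — `Ψ̂` and `Π_bm` fix multiplier legs), and for THAT column the END socket's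
# record-side rows (C) «co-closed» and (R) «mirror-even off the mirror axis» are TREE THEOREMS, not hypotheses:
# (C) = an2's `codiff₁_wΦ` (`KernelWardMColumn.wΦ_ward_resp`), (R) = an5's reflection covariance of the KKT columns (lit `ResolventReflection.wΦ_bref`)
# (β-function cell `pub-balaban`, BINDER-OWNERS row D1 ∕ (C1) OWNER «beta-an2» gen 76, PART 46; successor of PART 40–45)

WHY (located; journal road FP g53 INTENT-3 l.68655 = v10 `FP/StepRecursionFeedNestedNamedI` STAGED, SPEC-64 v3.1 §13 (3) «what the row's ONE file now owes, letter by letter»;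
J-NOTE-19 §4 STUB C ∕ STUB R; by value K1 §6 (i) (div 1.7e−17 at N = 3) and K2L-M2P7 (`wPhi9` co-closed 8.6e−15, reflection-covariant 1.4e−15 at N = 9) — zero weight).
The END socket `StepRecursionFeedNestedCompDoorPairingSummable` §5 (p670056) and v10 display the door tadpole as the covariant symmetrised pairing of a READ-OUT column
`Sd j ν z κ y` with door-word functionals, under four record-side rows (U) `hΘ`, (C) `hdiv : Σ_κ (Sd j ν 0 κ y − Sd j ν 0 κ (y − e_κ)) = 0`, (R) `hRA : ρ ≠ ν → κ ≠ ρ →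
Sd j ν 0 κ (Rf j ν ρ w) = Sd j ν 0 κ w`, `hRc : cz ρ (Rf j ν ρ w) = kf j ν ρ − cz ρ w`, (X) `hX`, plus covariance `hSd` and the summable cut `hSda`.  In (T2) (`hWΔT`) the read-out
weight is `perF T (AN ρc (n+1)) (wrapPt (L^{n+2}•β), inr β.2) (wrapPt (L^{n+2}•y′), inr ν)` — the torus periodisation of the chart's multiplier–multiplier block, which on the
lattice is `wΦ` BY NAME (`AN_inr_inr_smul`).  Hence the record's column is `Sd j ν z κ y := c_j · wΦ (N := Lc^(j+1)) κ ν (y − z)`, and for it: `hSd` is `sub_zero`; `hSda` is lit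
`KernelSpecInstance.absMoment₂_wΦ`; (C) is the response-slot co-closedness of the KKT multiplier column (an2 gen 15 `BorderedHessian.codiff₁_wΦ`: pair (EL) `d*dℋ = 𝒬ᵀφ + dδdμ`
with `codiff₁`, `codiff₁ ∘ curvAdj = 0`, `codiff₁ ∘ 𝒬ᵀ = 𝒬ᵀ-decimated coarse `codiff₁``); (R) is the multiplier–multiplier block of an5's `refK (Φ N ρ) KInv = KInv`
(`wΦ_bref`: `ε_ν ε_κ · wΦ κ ν (bref ρ κ y) = wΦ κ ν (y − bref ρ ν 0)`), which in the mirror's own coordinates `y_ρ ↦ −y_ρ` (`PolarizationSign.axisReflect`) reads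
`ε_ν ε_κ · wΦ κ ν (εy + ([ν = ρ] − [κ = ρ]) e_ρ) = wΦ κ ν y`: EVEN off the axis (`κ, ν ≠ ρ` — exactly `hRA`, with `Rf j ν ρ := ε_ρ`, `kf := 0`), ODD with the bond re-based on the
`ρ`-row ∕ `ρ`-column (J-NOTE-19 §4 STUB R «ρ-bonds to reversed ρ-bonds at `y_ρ ↦ −y_ρ − 1`»), even again on the diagonal `κ = ν = ρ`.

WHAT ([folklore] finite-sum ∕ sign bookkeeping BY NAME over tree theorems; no `def`, no `def … : Prop`, nothing cited, 0 sorry; generic dimension `d + 1`, blocking `N`):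
§1 (C) **`sum_wΦ_sub_wΦ_sub_unitVec`** — `Σ_κ (wΦ κ ν y − wΦ κ ν (y − e_κ)) = 0` (the socket's `hdiv` shape, `y − 0` free).
§2 (R) **`wΦ_axisReflect_signed`** (the general signed identity), **`wΦ_axisReflect_of_ne`** (`κ, ν ≠ ρ`: even — the socket's `hRA`), `wΦ_axisReflect_row` ∕ `_col` (one index on
the axis: odd with the re-based bond), `wΦ_axisReflect_diag`; `cast_axisReflect_self` (`((εw) ρ : ℝ) = 0 − w ρ` — the socket's `hRc` with `kf = 0`).
§3 THE SOCKET's ROWS FOR THE RECORD's COLUMN: for any storey-indexed blocking `Nb j`, constants `c j` and any `Sd` DISPLAYED as `hS : Sd j ν z κ y = c j · wΦ (N := Nb j) κ ν (y − z)`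
and any mirror family DISPLAYED as `hRf : Rf j ν ρ w = ε_ρ w`: **`hSd_of_wΦ`**, **`hSda_of_wΦ`**, **`hdiv_of_wΦ`**, **`hRA_of_wΦ`**, **`hRc_of_axisReflect`** — p670056 §5's ∕ v10's
`hSd hSda hdiv hRA hRc` VERBATIM in shape (with `eu κ = e_κ`, `cz ρ z = z ρ`, `kf = 0`).  §4 at the record (`d = 3`, `Nb j = Lc^(j+1)`): **`AN_readout_eq_wΦ`** — the chart's
multiplier–multiplier entry in the pairing's orientation (`AN_inr_inr_smul` re-lettered; the (X)∕(T2) stubs start here).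
WHAT THIS IS NOT: not LEMMA U (`hΘ`: the door WORD's column sum — the charts' uniform-data agreement, J-NOTE-19 §4; U3 = PART 45), not (X) `hX` nor (T2) `hWΔT` (the door
family `𝒲Δ` is NOT defined here), not `hτd ∕ hτda`; no tadpole ∕ moment claimed to vanish; v10 NOT filed (policy SPEC-64 §10 (4)); v9 p617999 stands; nothing of Bałaban's
asserted, valued or discharged; 0 estimates; 0∕4 row-D1 binders (hW, hR, D1Tel, D1Rep); ROOT M‴ p325680 ∕ P5c ∕ D6 untouched; (L2′) NOT discharged; NOT (C1), NOT (T-ID),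
NOT D1, NEVER «G-an2-4 closed», NOT BetaPertH, NOT continuum, NOT Clay.

HONEST DEPENDENCY (page 1, mandatory): continuum YM on T⁴ ⇐ BetaPertH ∧ nine spine estimates (0/9 proved); BetaPertH ⇐ (D1) ∧ (D4) ∧ CAP+tail;
G-an2-4 gates asym, D1 and NE2/3/4.  HONEST FRAMING (cell contract, verbatim): «discharging `BetaPertH` makes Bałaban's UV stability UNCONDITIONAL —
a real constructive-QFT result; it is NOT the continuum limit and NOT the Clay problem.»  ABSOLUTE RULE (cell charter, verbatim): «No internally-minted
statement may enter as a cited fact. Every hypothesis is either kernel-proved in this package or a verbatim quotation of a PUBLISHED theorem with page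
reference. The manuscript(s) under audit are NOT citable for their own disputed steps — they are the thing under adjudication; programme-internal
(2001/route/tribunal) claims are never citable.»  Row D1 ∕ (C1) OWNER «beta-an2» gen 76, 2026-08-28.  No existing file touched.
-/

noncomputable section

open Finset
open scoped BigOperators
open Literature.MathematicalPhysics.QuantumFieldTheory
open Literature.MathematicalPhysics.QuantumFieldTheory.Balaban1983to89
open Literature.MathematicalPhysics.QuantumFieldTheory.Balaban1983to89.Beta
open B6BondElimination (unitVec unitVec_apply)
open PolarizationSign (axisReflect axisReflect_apply axisReflect_axisReflect reflSign)
open KernelSpecInstance (wΦ absMoment₂_wΦ)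
open DecimatedMomentSummable (AbsMoment₂)
open ResolventReflection (bref bref_apply wΦ_bref)
open AffineAveraging (Site)
open Summit.QuantumFields.BalabanUV.Beta.KernelWardMColumn (wΦ_ward_resp)
open Summit.QuantumFields.BalabanUV.Beta.CompositeOneShotJetData (Roots AN)
open Summit.QuantumFields.BalabanUV.Beta.NVertexLamK1Prime (AN_inr_inr_smul)

namespace Summit.QuantumFields.BalabanUV.Beta.FP.TowerK2bDoorReadoutColumn

variable {d : ℕ}

/-! ## §1 (C) The multiplier response is co-closed in the response slot — the socket's `hdiv` shape -/

section Coclosed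

variable {N : ℕ} [NeZero N]

/-- [folklore] **(C) `Σ_κ (wΦ κ ν y − wΦ κ ν (y − e_κ)) = 0`** — the backward coarse divergence of the read-out column vanishes at every site
(`KernelWardMColumn.wΦ_ward_resp` at the source `0`, signs flipped). -/
theorem sum_wΦ_sub_wΦ_sub_unitVec (ν : Fin (d + 1)) (y : Fin (d + 1) → ℤ) :
    ∑ κ : Fin (d + 1), (wΦ (N := N) κ ν y - wΦ (N := N) κ ν (y - unitVec κ)) = 0 := by
  have h := wΦ_ward_resp (N := N) (d := d) ν y 0
  simp only [sub_zero] at h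
  have e : ∑ κ : Fin (d + 1), (wΦ (N := N) κ ν y - wΦ (N := N) κ ν (y - unitVec κ))
      = -∑ κ : Fin (d + 1), (wΦ (N := N) κ ν (y - unitVec κ) - wΦ (N := N) κ ν y) := by
    rw [← Finset.sum_neg_distrib]
    exact Finset.sum_congr rfl fun κ _ => by ring
  rw [e, h, neg_zero]

/-- [folklore] (C) with an explicit source: `Σ_κ (wΦ κ ν (y − z) − wΦ κ ν (y − e_κ − z)) = 0`. -/
theorem sum_wΦ_sub_sub_eq_zero (ν : Fin (d + 1)) (y z : Fin (d + 1) → ℤ) :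
    ∑ κ : Fin (d + 1), (wΦ (N := N) κ ν (y - z) - wΦ (N := N) κ ν (y - unitVec κ - z)) = 0 := by
  have h := sum_wΦ_sub_wΦ_sub_unitVec (N := N) ν (y - z)
  have e : ∀ κ : Fin (d + 1), y - z - unitVec κ = y - unitVec κ - z := fun κ => by abel
  simp_rw [e] at h
  exact h

end Coclosed

/-! ## §2 (R) The multiplier response under the coordinate mirror `y_ρ ↦ −y_ρ` -/

section Mirror

variable {N : ℕ} [NeZero N]

/-- [folklore] **THE SIGNED MIRROR IDENTITY IN THE MIRROR's OWN COORDINATES**: for every axis `ρ` and legs `κ, ν`,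
`ε_ν ε_κ · wΦ κ ν (εy + ([ν = ρ] − [κ = ρ]) • e_ρ) = wΦ κ ν y` with `ε = reflSign ρ`, `εy = axisReflect ρ y`
(lit `wΦ_bref` at `y − (1 + [ν = ρ]) • e_ρ`: `bref ρ κ (·)` of that point is `εy + ([ν = ρ] − [κ = ρ]) • e_ρ` and `· − bref ρ ν 0 = y`). -/
theorem wΦ_axisReflect_signed (ρ κ ν : Fin (d + 1)) (y : Fin (d + 1) → ℤ) :
    reflSign ρ ν * reflSign ρ κ *
        wΦ (N := N) κ ν (axisReflect ρ y + ((if ν = ρ then (1 : ℤ) else 0) - (if κ = ρ then (1 : ℤ) else 0)) • unitVec ρ)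
      = wΦ (N := N) κ ν y := by
  have h := wΦ_bref (N := N) ρ κ ν (y - (1 + (if ν = ρ then (1 : ℤ) else 0)) • unitVec ρ)
  have e1 : y - (1 + (if ν = ρ then (1 : ℤ) else 0)) • unitVec ρ - bref ρ ν 0 = y := by
    funext i
    simp only [Pi.sub_apply, Pi.smul_apply, smul_eq_mul, unitVec_apply, bref_apply, Pi.zero_apply]
    by_cases hi : i = ρ
    · subst hi
      by_cases hν : ν = i <;> simp [hν]
    · simp [hi]
  have e2 : bref ρ κ (y - (1 + (if ν = ρ then (1 : ℤ) else 0)) • unitVec ρ)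
      = axisReflect ρ y + ((if ν = ρ then (1 : ℤ) else 0) - (if κ = ρ then (1 : ℤ) else 0)) • unitVec ρ := by
    funext i
    simp only [Pi.sub_apply, Pi.add_apply, Pi.smul_apply, smul_eq_mul, unitVec_apply, bref_apply, axisReflect_apply]
    by_cases hi : i = ρ
    · subst hi
      by_cases hν : ν = i <;> by_cases hκ : κ = i <;> simp [hν, hκ] <;> ring
    · simp [hi]
  rw [e1, e2, ← mul_assoc] at h
  exact h

/-- [folklore] **(R) EVEN OFF THE AXIS — the socket's `hRA`**: for `κ ≠ ρ` and `ν ≠ ρ`, `wΦ κ ν (εy) = wΦ κ ν y`. -/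
theorem wΦ_axisReflect_of_ne {ρ κ ν : Fin (d + 1)} (hκ : κ ≠ ρ) (hν : ν ≠ ρ) (y : Fin (d + 1) → ℤ) :
    wΦ (N := N) κ ν (axisReflect ρ y) = wΦ (N := N) κ ν y := by
  have h := wΦ_axisReflect_signed (N := N) ρ κ ν y
  simp only [reflSign, hκ, hν, if_false, one_mul, sub_self, zero_smul, add_zero] at h
  exact h

/-- [folklore] (R) ODD ON THE RESPONSE ROW `κ = ρ` (`ν ≠ ρ`): the mirrored `ρ`-bond is re-based at `−y_ρ − 1` and the entry flips sign:
`wΦ ρ ν (εy − e_ρ) = −wΦ ρ ν y`. -/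
theorem wΦ_axisReflect_row {ρ ν : Fin (d + 1)} (hν : ν ≠ ρ) (y : Fin (d + 1) → ℤ) :
    wΦ (N := N) ρ ν (axisReflect ρ y - unitVec ρ) = -wΦ (N := N) ρ ν y := by
  have h := wΦ_axisReflect_signed (N := N) ρ ρ ν y
  simp only [reflSign, hν, if_false, if_true, one_mul, zero_sub, neg_smul, one_smul, ← sub_eq_add_neg] at h
  linarith

/-- [folklore] (R) ODD ON THE SOURCE COLUMN `ν = ρ` (`κ ≠ ρ`): `wΦ κ ρ (εy + e_ρ) = −wΦ κ ρ y`. -/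
theorem wΦ_axisReflect_col {ρ κ : Fin (d + 1)} (hκ : κ ≠ ρ) (y : Fin (d + 1) → ℤ) :
    wΦ (N := N) κ ρ (axisReflect ρ y + unitVec ρ) = -wΦ (N := N) κ ρ y := by
  have h := wΦ_axisReflect_signed (N := N) ρ κ ρ y
  simp only [reflSign, hκ, if_false, if_true, mul_one, sub_zero, one_smul, neg_mul, one_mul] at h
  linarith

/-- [folklore] (R) EVEN ON THE DIAGONAL `κ = ν = ρ`: `wΦ ρ ρ (εy) = wΦ ρ ρ y`. -/
theorem wΦ_axisReflect_diag (ρ : Fin (d + 1)) (y : Fin (d + 1) → ℤ) :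
    wΦ (N := N) ρ ρ (axisReflect ρ y) = wΦ (N := N) ρ ρ y := by
  have h := wΦ_axisReflect_signed (N := N) ρ ρ ρ y
  simp only [reflSign, if_true, sub_self, zero_smul, add_zero] at h
  linarith

omit [NeZero N] in
/-- [folklore] the mirrored coordinate, as the socket's `hRc` reads it (`kf = 0`): `((εw) ρ : ℝ) = 0 − w ρ`. -/
theorem cast_axisReflect_self (ρ : Fin (d + 1)) (w : Fin (d + 1) → ℤ) :
    ((axisReflect ρ w ρ : ℤ) : ℝ) = 0 - ((w ρ : ℤ) : ℝ) := by
  rw [axisReflect_apply, if_pos rfl, Int.cast_neg, zero_sub]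

omit [NeZero N] in
/-- [folklore] … and the other coordinates are untouched: `((εw) κ : ℝ) = w κ` for `κ ≠ ρ`. -/
theorem cast_axisReflect_of_ne {ρ κ : Fin (d + 1)} (hκ : κ ≠ ρ) (w : Fin (d + 1) → ℤ) :
    ((axisReflect ρ w κ : ℤ) : ℝ) = ((w κ : ℤ) : ℝ) := by
  rw [axisReflect_apply, if_neg hκ]

end Mirror

/-! ## §3 The END socket's read-out rows for the record's column `Sd j ν z κ y := c j · wΦ (N := Nb j) κ ν (y − z)` -/

section Socket

variable (Nb : ℕ → ℕ) [∀ j, NeZero (Nb j)] (c : ℕ → ℝ)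
  (Sd : ℕ → Fin (d + 1) → (Fin (d + 1) → ℤ) → Fin (d + 1) → (Fin (d + 1) → ℤ) → ℝ)
  (hS : ∀ (j : ℕ) (ν : Fin (d + 1)) (z : Fin (d + 1) → ℤ) (κ : Fin (d + 1)) (y : Fin (d + 1) → ℤ),
    Sd j ν z κ y = c j * wΦ (N := Nb j) κ ν (y - z))

include hS

/-- [folklore] **`hSd` FOR THE RECORD's COLUMN** (translation covariance): `Sd j ν z κ y = Sd j ν 0 κ (y − z)` (`sub_zero`). -/
theorem hSd_of_wΦ (j : ℕ) (ν : Fin (d + 1)) (z : Fin (d + 1) → ℤ) (κ : Fin (d + 1)) (y : Fin (d + 1) → ℤ) :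
    Sd j ν z κ y = Sd j ν 0 κ (y - z) := by
  rw [hS, hS, sub_zero]

/-- [folklore] **`hSda` FOR THE RECORD's COLUMN** (the summable cut): `AbsMoment₂ (w ↦ Sd j ν 0 κ w)` (lit `absMoment₂_wΦ`, scaled). -/
theorem hSda_of_wΦ (j : ℕ) (ν κ : Fin (d + 1)) : AbsMoment₂ (fun w => Sd j ν 0 κ w) := by
  have h : AbsMoment₂ (wΦ (N := Nb j) κ ν) := absMoment₂_wΦ (N := Nb j) κ ν
  have e : (fun w => Sd j ν 0 κ w) = fun w => c j * wΦ (N := Nb j) κ ν w := by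
    funext w; rw [hS, sub_zero]
  rw [e]
  unfold DecimatedMomentSummable.AbsMoment₂ at h ⊢
  refine (h.mul_left |c j|).congr fun w => ?_
  rw [abs_mul]; ring

/-- [folklore] **(C) `hdiv` FOR THE RECORD's COLUMN**: `Σ_κ (Sd j ν 0 κ y − Sd j ν 0 κ (y − e_κ)) = 0` (§1, scaled). -/
theorem hdiv_of_wΦ (j : ℕ) (ν : Fin (d + 1)) (y : Fin (d + 1) → ℤ) :
    ∑ κ : Fin (d + 1), (Sd j ν 0 κ y - Sd j ν 0 κ (y - unitVec κ)) = 0 := by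
  have h := sum_wΦ_sub_wΦ_sub_unitVec (N := Nb j) ν y
  have e : ∑ κ : Fin (d + 1), (Sd j ν 0 κ y - Sd j ν 0 κ (y - unitVec κ))
      = c j * ∑ κ : Fin (d + 1), (wΦ (N := Nb j) κ ν y - wΦ (N := Nb j) κ ν (y - unitVec κ)) := by
    rw [Finset.mul_sum]
    exact Finset.sum_congr rfl fun κ _ => by rw [hS, hS, sub_zero, sub_zero]; ring
  rw [e, h, mul_zero]

/-- [folklore] **(R) `hRA` FOR THE RECORD's COLUMN AND THE COORDINATE MIRRORS**: for a mirror family DISPLAYED as `Rf j ν ρ w = ε_ρ w`, `ρ ≠ ν` and `κ ≠ ρ`,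
`Sd j ν 0 κ (Rf j ν ρ w) = Sd j ν 0 κ w` (§2 `wΦ_axisReflect_of_ne`). -/
theorem hRA_of_wΦ (Rf : ℕ → Fin (d + 1) → Fin (d + 1) → (Fin (d + 1) → ℤ) ≃ (Fin (d + 1) → ℤ))
    (hRf : ∀ (j : ℕ) (ν ρ : Fin (d + 1)) (w : Fin (d + 1) → ℤ), Rf j ν ρ w = axisReflect ρ w)
    (j : ℕ) (ν ρ : Fin (d + 1)) (hρ : ρ ≠ ν) (κ : Fin (d + 1)) (hκ : κ ≠ ρ) (w : Fin (d + 1) → ℤ) :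
    Sd j ν 0 κ (Rf j ν ρ w) = Sd j ν 0 κ w := by
  rw [hS, hS, hRf, sub_zero, sub_zero, wΦ_axisReflect_of_ne (N := Nb j) hκ (Ne.symm hρ)]

omit hS in
/-- [folklore] **(R) `hRc` FOR THE COORDINATE MIRRORS** (`kf = 0`): for a coordinate read-out DISPLAYED as `hcz : cz ρ z = z ρ` and `Rf j ν ρ w = ε_ρ w`,
`cz ρ (Rf j ν ρ w) = 0 − cz ρ w`. -/
theorem hRc_of_axisReflect (cz : Fin (d + 1) → (Fin (d + 1) → ℤ) →+ ℝ) (hcz : ∀ (ρ : Fin (d + 1)) (z : Fin (d + 1) → ℤ), cz ρ z = ((z ρ : ℤ) : ℝ))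
    (Rf : ℕ → Fin (d + 1) → Fin (d + 1) → (Fin (d + 1) → ℤ) ≃ (Fin (d + 1) → ℤ))
    (hRf : ∀ (j : ℕ) (ν ρ : Fin (d + 1)) (w : Fin (d + 1) → ℤ), Rf j ν ρ w = axisReflect ρ w)
    (j : ℕ) (ν ρ : Fin (d + 1)) (w : Fin (d + 1) → ℤ) :
    cz ρ (Rf j ν ρ w) = 0 - cz ρ w := by
  rw [hcz, hcz, hRf, cast_axisReflect_self]

end Socket

/-! ## §4 At the record: the chart's read-out entry in the pairing's orientation -/

section Record

variable {Lc : ℕ} [NeZero Lc] (R : Roots Lc) (j : ℕ)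

/-- [folklore] **`AN_readout_eq_wΦ`** — the composite one-shot chart's multiplier–multiplier entry between the response bond `(κ, y)` and the source bond `(ν, z)`
(coarse labels, fine points `Lc^(j+1) • ·`) is the straight system's multiplier response `wΦ κ ν (y − z)` — the lattice column whose torus periodisation (T2)
contracts (`NVertexLamK1Prime.AN_inr_inr_smul`, re-lettered to the pairing's `Sd j ν z κ y`). -/
theorem AN_readout_eq_wΦ (ν : Fin (3 + 1)) (z : Site (3 + 1)) (κ : Fin (3 + 1)) (y : Site (3 + 1)) :
    AN R j (((Lc ^ (j + 1) : ℕ) : ℤ) • y) (((Lc ^ (j + 1) : ℕ) : ℤ) • z) (Sum.inr κ) (Sum.inr ν)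
      = wΦ (N := Lc ^ (j + 1)) κ ν (y - z) :=
  AN_inr_inr_smul R j κ ν y z

/-- [folklore] … hence the chart's read-out column is co-closed in the response slot (§1 at `N = Lc^(j+1)`). -/
theorem sum_AN_readout_sub_eq_zero (ν : Fin (3 + 1)) (z : Site (3 + 1)) (y : Site (3 + 1)) :
    ∑ κ : Fin (3 + 1), (AN R j (((Lc ^ (j + 1) : ℕ) : ℤ) • y) (((Lc ^ (j + 1) : ℕ) : ℤ) • z) (Sum.inr κ) (Sum.inr ν)
        - AN R j (((Lc ^ (j + 1) : ℕ) : ℤ) • (y - unitVec κ)) (((Lc ^ (j + 1) : ℕ) : ℤ) • z) (Sum.inr κ) (Sum.inr ν)) = 0 := by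
  simp_rw [AN_readout_eq_wΦ]
  exact sum_wΦ_sub_sub_eq_zero (N := Lc ^ (j + 1)) ν y z

/-- [folklore] … and mirror-even off the mirror axis at the source `z = 0` (§2 at `N = Lc^(j+1)`; `ε_ρ 0 = 0`). -/
theorem AN_readout_axisReflect_of_ne {ρ κ ν : Fin (3 + 1)} (hκ : κ ≠ ρ) (hν : ν ≠ ρ) (y : Site (3 + 1)) :
    AN R j (((Lc ^ (j + 1) : ℕ) : ℤ) • axisReflect ρ y) 0 (Sum.inr κ) (Sum.inr ν)
      = AN R j (((Lc ^ (j + 1) : ℕ) : ℤ) • y) 0 (Sum.inr κ) (Sum.inr ν) := by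
  have h0 : (((Lc ^ (j + 1) : ℕ) : ℤ) • (0 : Site (3 + 1))) = 0 := smul_zero _
  rw [← h0, AN_readout_eq_wΦ, AN_readout_eq_wΦ, sub_zero, sub_zero]
  exact wΦ_axisReflect_of_ne (N := Lc ^ (j + 1)) hκ hν y

end Record

end Summit.QuantumFields.BalabanUV.Beta.FP.TowerK2bDoorReadoutColumn

end
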